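import Literature.MathematicalPhysics.QuantumLattice.HubbardNNNHoppingEnergyDensityRegionBounds
import Mathlib.Order.Interval.Set.Pi
import Mathlib.Data.Fin.VecNotation
import HarnessLib

/-!
# Reading a certified cell window of the `t–t'` Hubbard energy density OUTSIDE its cell: the
# open-box extensions in `U` (monotone / Lipschitz), in `t'` (Lipschitz) and in the density
# (convex extrapolation), in the scalar letters and in the S2-seam `Set.Icc` shape

Family `hubbard` (topic `MathematicalPhysics/QuantumLattice`); written for stage S2 of the Hubbard
material oracle ("points → boxes", D-0096/D-0097), companion of `HubbardTTPrimeBoxWordCovering`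
(a delivered box INSIDE a union of certified cells carries the weakest cell word). The situation this
file serves is the generic one at the S1/S2 seam: the MATERIAL box delivered by the router is NOT
inside the certified cells — its `U/t` axis is open above (a one-band `U/t` hull `[7.9, 14.7]`
against cells certified on `[7.5, 8.5]`), its density interval is wider than the cells'
(`0.875 ± 0.02` against `± 0.01`), its `t'/t` interval overshoots a cell edge. Nothing new is solved:
a cell word — a two-sided window `F ≤ e(t, s, u, m) ≤ C` for all `(u, s, m)` in
`[U₁, U₂] × [s₁, s₂] × [n₁, n₂]` (coordinates `(U, t', n)`, the router's order; `e = energyDensityTT'`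
takes `(t, t', U, n)`) — is READ on a larger box through three structural facts already in the tree:

* `U ↦ e` is nondecreasing (`energyDensityTT'_mono_U`) and `(n/2)²`-Lipschitz
  (`abs_energyDensityTT'_sub_U_le`, `energyDensityTT'_ge_sub_mul_sq_U`) on `U ≥ 0`;
* `t' ↦ e` is `4n`-Lipschitz (`energyDensityTT'_ge_of_lowerBound_tPrime`,
  `energyDensityTT'_le_of_upperBound_tPrime`);
* `n ↦ e` is convex, so a cap at one density and a floor at a larger (smaller) one extrapolate to a
  FLOOR further right (left) (`energyDensityTT'_ge_density_extrapolate_right/left`).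

Contents (every statement is a composition of the above with `min`/`max` interval bookkeeping):

* §1 SCALAR LETTERS. `energyDensityTT'_ge_of_cellFloor_U_above` — the floor survives on the whole
  `U`-shadow `u ≥ U₁` at ZERO loss (an open-above `U` axis costs the floor nothing);
  `energyDensityTT'_le_of_cellCap_U_below` — the cap survives for `0 ≤ u ≤ U₂`;
  `energyDensityTT'_le_of_cellCap_U_above` / `energyDensityTT'_ge_of_cellFloor_U_below` — the other
  two directions at the Lipschitz price `(n₂/2)² · distance`; `energyDensityTT'_mem_Icc_of_cellWindow_U`
  — the window on `[U₀, U₃] × [s₁, s₂] × [n₁, n₂]` (`U₀ ≥ 0`), losses evaluated at the far edges.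
  `energyDensityTT'_ge/le_of_cell…_tPrime`, `energyDensityTT'_mem_Icc_of_cellWindow_tPrime` — the
  same in `t'` at the price `4 n₂ · overshoot`.
  `energyDensityTT'_ge_of_cellWindow_density_right/left` (pointwise) and
  `energyDensityTT'_ge_min_of_cellWindow_density_right/left` (uniform on a density slab
  `[n₂, n₃]` / `[n₀, n₁]`) — FLOORS outside the density interval from the cell's own window; no cap is
  claimed there (convexity gives none).
* §2 THE S2-SEAM SHAPE `∀ θ ∈ Set.Icc ![U₁, s₁, n₁] ![U₂, s₂, n₂], F ≤ e t (θ 1) (θ 0) (θ 2) ∧ … ≤ C`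
  (literally the conclusion shape of the landed box words `…_word_Icc` and the hypothesis shape of
  `Downfold.S2Seam.holdsOn_of_forall_s2Box`): `forall₃_of_forall_mem_Icc_vec3` /
  `forall_mem_Icc_vec3_of_forall₃` (scalar letters ↔ vector box), and the extensions
  `energyDensityTT'_floor_Icc₃_U_above`, `energyDensityTT'_window_Icc₃_U`,
  `energyDensityTT'_window_Icc₃_tPrime`, `energyDensityTT'_floor_Icc₃_density_right/left` — each maps a
  word on one `Set.Icc` box to a word on a larger `Set.Icc` box, so they chain, and the extended boxes
  enter the covering certificates (`BoxCoverCertificate.forall_mem_Icc_or_gap_of_kdCheck`,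
  `Downfold.S2SeamCover`) as ordinary cells carrying one-sided or degraded words.

ORDER OF COMPOSITION (the only non-mechanical point): extrapolate in the density FIRST (it needs the
floor and the cap at the same `(t', U)`), then transport floors in `U` upward for free and everything
else at the Lipschitz prices. HONEST FRAMING: transport bookkeeping of whatever the cell carries; no
number, no certificate, no phase sentence; the words degrade linearly with the distance from the cell
except the floor in `+U`, which does not degrade at all.

## Mathlib / tree search

Tree: `energyDensityTT'_mono_U`, `energyDensityTT'_anchor_le` (point form of the `+U` floor
transport), `abs_energyDensityTT'_sub_U_le`, `energyDensityTT'_ge_sub_mul_sq_U`,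
`energyDensityTT'_ge/le_of_lower/upperBound_tPrime`, `energyDensityTT'_ge_density_extrapolate_right/left`
(all `HubbardNNNHoppingEnergyDensity{Monotone,RegionBounds}`); `energyDensityTT'_rect_ge/le_of_anchor`
(`HubbardTTPrimeBoxWordCovering` §5: ONE anchor point ⇒ rectangle; this file: one CELL ⇒ bigger box,
and the density direction). `lean search 'U_above|U_below|Icc₃|cellWindow'`: nothing prior.

## References

* D. Ruelle, *Statistical Mechanics: Rigorous Results* (1969), §3.3–3.4 (existence, monotonicity and
  convexity properties of thermodynamic-limit densities). [cite: Ruelle1969, §3.3]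
* V. Bach, E. H. Lieb, J. P. Solovej, J. Stat. Phys. 76 (1994) 3, eq. (2c.36) (Hartree–Fock ceiling
  ⇒ `(n/2)²` Lipschitz constant in `U`). [cite: BachLiebSolovej1994, eq. (2c.36)]
* R. B. Israel, *Convexity in the Theory of Lattice Gases* (1979), Thm. I.3.4 (concavity in linear
  couplings; tangent functionals). [cite: Israel1979, Thm. I.3.4]
* A. Neumaier, Acta Numerica 13 (2004) 271–369, §11 (range of a monotone / Lipschitz expression over a
  box is controlled at the end points). [cite: Neumaier2004CompleteSearch, §11]
-/

noncomputable section

namespace Literature.MathematicalPhysics.QuantumLattice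

namespace ThermodynamicLimit

/-! ### §1 Scalar letters: a cell window read outside the cell -/

/-- **Floor on the `U`-shadow above the cell, zero loss.** A floor `F ≤ e(t, s, u, m)` certified on the
cell `[U₁, U₂] × [s₁, s₂] × [n₁, n₂]` (`0 ≤ U₁ ≤ U₂`, `0 ≤ n₁`, `n₂ < 2`) holds at EVERY `u ≥ U₁` (same
`s`, `m` ranges): `U ↦ e` is nondecreasing (`energyDensityTT'_mono_U`, read at `min u U₂`).
[cite: Ruelle1969, §3.3] -/
theorem energyDensityTT'_ge_of_cellFloor_U_above (t : ℝ) {U₁ U₂ s₁ s₂ n₁ n₂ F : ℝ} (hU₁ : 0 ≤ U₁)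
    (hU : U₁ ≤ U₂) (hn₁ : 0 ≤ n₁) (hn₂ : n₂ < 2)
    (hF : ∀ u s m : ℝ, U₁ ≤ u → u ≤ U₂ → s₁ ≤ s → s ≤ s₂ → n₁ ≤ m → m ≤ n₂ →
      F ≤ energyDensityTT' t s u m)
    {u s m : ℝ} (hu : U₁ ≤ u) (hs₁ : s₁ ≤ s) (hs₂ : s ≤ s₂) (hm₁ : n₁ ≤ m) (hm₂ : m ≤ n₂) :
    F ≤ energyDensityTT' t s u m := by
  have hm0 : 0 ≤ m := hn₁.trans hm₁
  have hm2 : m < 2 := lt_of_le_of_lt hm₂ hn₂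
  have h1 : F ≤ energyDensityTT' t s (min u U₂) m :=
    hF _ _ _ (le_min hu hU) (min_le_right _ _) hs₁ hs₂ hm₁ hm₂
  exact h1.trans (energyDensityTT'_mono_U t s hm0 hm2 (hU₁.trans (le_min hu hU)) (min_le_left _ _))

/-- **Cap on the `U`-shadow below the cell, zero loss.** A cap `e(t, s, u, m) ≤ C` certified on the cell
holds at every `0 ≤ u ≤ U₂` (monotonicity, read at `max u U₁`). [cite: Ruelle1969, §3.3] -/
theorem energyDensityTT'_le_of_cellCap_U_below (t : ℝ) {U₁ U₂ s₁ s₂ n₁ n₂ C : ℝ}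
    (hU : U₁ ≤ U₂) (hn₁ : 0 ≤ n₁) (hn₂ : n₂ < 2)
    (hC : ∀ u s m : ℝ, U₁ ≤ u → u ≤ U₂ → s₁ ≤ s → s ≤ s₂ → n₁ ≤ m → m ≤ n₂ →
      energyDensityTT' t s u m ≤ C)
    {u s m : ℝ} (hu0 : 0 ≤ u) (hu : u ≤ U₂) (hs₁ : s₁ ≤ s) (hs₂ : s ≤ s₂) (hm₁ : n₁ ≤ m)
    (hm₂ : m ≤ n₂) : energyDensityTT' t s u m ≤ C := by
  have hm0 : 0 ≤ m := hn₁.trans hm₁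
  have hm2 : m < 2 := lt_of_le_of_lt hm₂ hn₂
  have h1 : energyDensityTT' t s (max u U₁) m ≤ C :=
    hC _ _ _ (le_max_right _ _) (max_le hu hU) hs₁ hs₂ hm₁ hm₂
  exact (energyDensityTT'_mono_U t s hm0 hm2 hu0 (le_max_left _ _)).trans h1

/-- Squares of half-densities are monotone on `0 ≤ m ≤ n₂`. [folklore] -/
private theorem sq_half_le {m n₂ : ℝ} (hm0 : 0 ≤ m) (hm : m ≤ n₂) : (m / 2) ^ 2 ≤ (n₂ / 2) ^ 2 := by
  have h1 : 0 ≤ m / 2 := by linarith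
  have h2 : m / 2 ≤ n₂ / 2 := by linarith
  nlinarith

/-- **Cap on the `U`-shadow above the cell, Lipschitz price.** A cap `e ≤ C` certified on the cell
gives, at every `u ≥ U₁` (same `s`, `m` ranges), `e(t, s, u, m) ≤ C + max (u − U₂) 0 · (n₂/2)²`
(`abs_energyDensityTT'_sub_U_le` from the cell's upper face; inside the cell the `max` vanishes).
[cite: BachLiebSolovej1994, eq. (2c.36)] -/
theorem energyDensityTT'_le_of_cellCap_U_above (t : ℝ) {U₁ U₂ s₁ s₂ n₁ n₂ C : ℝ} (hU₁ : 0 ≤ U₁)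
    (hU : U₁ ≤ U₂) (hn₁ : 0 ≤ n₁) (hn₂ : n₂ < 2)
    (hC : ∀ u s m : ℝ, U₁ ≤ u → u ≤ U₂ → s₁ ≤ s → s ≤ s₂ → n₁ ≤ m → m ≤ n₂ →
      energyDensityTT' t s u m ≤ C)
    {u s m : ℝ} (hu : U₁ ≤ u) (hs₁ : s₁ ≤ s) (hs₂ : s ≤ s₂) (hm₁ : n₁ ≤ m) (hm₂ : m ≤ n₂) :
    energyDensityTT' t s u m ≤ C + max (u - U₂) 0 * (n₂ / 2) ^ 2 := by
  have hm0 : 0 ≤ m := hn₁.trans hm₁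
  have hm2 : m < 2 := lt_of_le_of_lt hm₂ hn₂
  have hsq : (m / 2) ^ 2 ≤ (n₂ / 2) ^ 2 := sq_half_le hm0 hm₂
  have hnn : 0 ≤ max (u - U₂) 0 * (n₂ / 2) ^ 2 := mul_nonneg (le_max_right _ _) (sq_nonneg _)
  rcases le_total u U₂ with hle | hle
  · have h1 := hC u s m hu hle hs₁ hs₂ hm₁ hm₂
    linarith
  · have hU₂0 : 0 ≤ U₂ := hU₁.trans hU
    have h1 := hC U₂ s m hU le_rfl hs₁ hs₂ hm₁ hm₂
    have h2 := abs_energyDensityTT'_sub_U_le t s hm0 hm2 (hU₂0.trans hle) hU₂0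
    rw [abs_of_nonneg (sub_nonneg.2 hle)] at h2
    have h3 := (le_abs_self _).trans h2
    have h4 : (u - U₂) * (m / 2) ^ 2 ≤ max (u - U₂) 0 * (n₂ / 2) ^ 2 :=
      mul_le_mul (le_max_left _ _) hsq (sq_nonneg _) (le_max_right _ _)
    linarith

/-- **Floor on the `U`-shadow below the cell, Lipschitz price.** A floor `F ≤ e` certified on the cell
gives, at every `0 ≤ u ≤ U₂`, `F − max (U₁ − u) 0 · (n₂/2)² ≤ e(t, s, u, m)`
(`energyDensityTT'_ge_sub_mul_sq_U` from the cell's lower face). [cite: BachLiebSolovej1994, eq. (2c.36)] -/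
theorem energyDensityTT'_ge_of_cellFloor_U_below (t : ℝ) {U₁ U₂ s₁ s₂ n₁ n₂ F : ℝ}
    (hU : U₁ ≤ U₂) (hn₁ : 0 ≤ n₁) (hn₂ : n₂ < 2)
    (hF : ∀ u s m : ℝ, U₁ ≤ u → u ≤ U₂ → s₁ ≤ s → s ≤ s₂ → n₁ ≤ m → m ≤ n₂ →
      F ≤ energyDensityTT' t s u m)
    {u s m : ℝ} (hu0 : 0 ≤ u) (hu : u ≤ U₂) (hs₁ : s₁ ≤ s) (hs₂ : s ≤ s₂) (hm₁ : n₁ ≤ m)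
    (hm₂ : m ≤ n₂) : F - max (U₁ - u) 0 * (n₂ / 2) ^ 2 ≤ energyDensityTT' t s u m := by
  have hm0 : 0 ≤ m := hn₁.trans hm₁
  have hm2 : m < 2 := lt_of_le_of_lt hm₂ hn₂
  have hsq : (m / 2) ^ 2 ≤ (n₂ / 2) ^ 2 := sq_half_le hm0 hm₂
  have hnn : 0 ≤ max (U₁ - u) 0 * (n₂ / 2) ^ 2 := mul_nonneg (le_max_right _ _) (sq_nonneg _)
  rcases le_total U₁ u with hle | hle
  · have h1 := hF u s m hle hu hs₁ hs₂ hm₁ hm₂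
    linarith
  · have h1 := hF U₁ s m le_rfl hU hs₁ hs₂ hm₁ hm₂
    have h2 := energyDensityTT'_ge_sub_mul_sq_U t s hm0 hm2 hu0 hle
    have h4 : (U₁ - u) * (m / 2) ^ 2 ≤ max (U₁ - u) 0 * (n₂ / 2) ^ 2 :=
      mul_le_mul (le_max_left _ _) hsq (sq_nonneg _) (le_max_right _ _)
    linarith

/-- **The cell window read on a `U`-extended box.** A window `F ≤ e ≤ C` certified on
`[U₁, U₂] × [s₁, s₂] × [n₁, n₂]` is, on `[U₀, U₃] × [s₁, s₂] × [n₁, n₂]` (`0 ≤ U₀`), the window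
`[F − max (U₁ − U₀) 0 · (n₂/2)², C + max (U₃ − U₂) 0 · (n₂/2)²]` — the floor pays only for going
BELOW the cell, the cap only for going ABOVE it. [cite: Ruelle1969, §3.3] -/
theorem energyDensityTT'_mem_Icc_of_cellWindow_U (t : ℝ) {U₁ U₂ s₁ s₂ n₁ n₂ F C : ℝ} (hU₁ : 0 ≤ U₁)
    (hU : U₁ ≤ U₂) (hn₁ : 0 ≤ n₁) (hn₂ : n₂ < 2)
    (hW : ∀ u s m : ℝ, U₁ ≤ u → u ≤ U₂ → s₁ ≤ s → s ≤ s₂ → n₁ ≤ m → m ≤ n₂ →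
      F ≤ energyDensityTT' t s u m ∧ energyDensityTT' t s u m ≤ C)
    {U₀ U₃ : ℝ} (hU₀ : 0 ≤ U₀) {u s m : ℝ} (hu₀ : U₀ ≤ u) (hu₃ : u ≤ U₃) (hs₁ : s₁ ≤ s)
    (hs₂ : s ≤ s₂) (hm₁ : n₁ ≤ m) (hm₂ : m ≤ n₂) :
    energyDensityTT' t s u m ∈ Set.Icc (F - max (U₁ - U₀) 0 * (n₂ / 2) ^ 2)
      (C + max (U₃ - U₂) 0 * (n₂ / 2) ^ 2) := by
  have hsq : 0 ≤ (n₂ / 2) ^ 2 := sq_nonneg _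
  have hu0 : 0 ≤ u := hU₀.trans hu₀
  refine ⟨?_, ?_⟩
  · rcases le_total u U₂ with hle | hle
    · have h := energyDensityTT'_ge_of_cellFloor_U_below t hU hn₁ hn₂
        (fun u s m h₁ h₂ h₃ h₄ h₅ h₆ => (hW u s m h₁ h₂ h₃ h₄ h₅ h₆).1) hu0 hle hs₁ hs₂ hm₁ hm₂
      have hmax : max (U₁ - u) 0 ≤ max (U₁ - U₀) 0 :=
        max_le_max (by linarith) le_rfl
      have := mul_le_mul_of_nonneg_right hmax hsq
      linarith
    · have h := energyDensityTT'_ge_of_cellFloor_U_above t hU₁ hU hn₁ hn₂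
        (fun u s m h₁ h₂ h₃ h₄ h₅ h₆ => (hW u s m h₁ h₂ h₃ h₄ h₅ h₆).1) (hU.trans hle) hs₁ hs₂ hm₁ hm₂
      have : 0 ≤ max (U₁ - U₀) 0 * (n₂ / 2) ^ 2 := mul_nonneg (le_max_right _ _) hsq
      linarith
  · rcases le_total u U₁ with hle | hle
    · have h := energyDensityTT'_le_of_cellCap_U_below t hU hn₁ hn₂
        (fun u s m h₁ h₂ h₃ h₄ h₅ h₆ => (hW u s m h₁ h₂ h₃ h₄ h₅ h₆).2) hu0 (hle.trans hU) hs₁ hs₂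
        hm₁ hm₂
      have : 0 ≤ max (U₃ - U₂) 0 * (n₂ / 2) ^ 2 := mul_nonneg (le_max_right _ _) hsq
      linarith
    · have h := energyDensityTT'_le_of_cellCap_U_above t hU₁ hU hn₁ hn₂
        (fun u s m h₁ h₂ h₃ h₄ h₅ h₆ => (hW u s m h₁ h₂ h₃ h₄ h₅ h₆).2) hle hs₁ hs₂ hm₁ hm₂
      have hmax : max (u - U₂) 0 ≤ max (U₃ - U₂) 0 := max_le_max (by linarith) le_rfl
      have := mul_le_mul_of_nonneg_right hmax hsq
      linarith

/-- The distance from `s'` to the interval `[s₁, s₂]`, i.e. to its clamp `max s₁ (min s' s₂)`, is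
`max (max (s₁ − s') (s' − s₂)) 0` when `s₁ ≤ s₂`. [folklore] -/
private theorem abs_sub_clamp_le {s' s₁ s₂ : ℝ} (h : s₁ ≤ s₂) :
    |s' - max s₁ (min s' s₂)| ≤ max (max (s₁ - s') (s' - s₂)) 0 := by
  rcases le_total s' s₁ with h₁ | h₁
  · have e : max s₁ (min s' s₂) = s₁ := by
      rw [min_eq_left (h₁.trans h), max_eq_left h₁]
    rw [e, abs_of_nonpos (by linarith)]
    exact le_trans (by linarith) ((le_max_left _ _).trans (le_max_left _ _))
  rcases le_total s' s₂ with h₂ | h₂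
  · have e : max s₁ (min s' s₂) = s' := by rw [min_eq_left h₂, max_eq_right h₁]
    rw [e, sub_self, abs_zero]
    exact le_max_right _ _
  · have e : max s₁ (min s' s₂) = s₂ := by rw [min_eq_right h₂, max_eq_right h]
    rw [e, abs_of_nonneg (by linarith)]
    exact le_trans (by linarith) ((le_max_right _ _).trans (le_max_left _ _))

/-- **Floor read outside the cell in `t'`, Lipschitz price `4 n₂`.** A floor `F ≤ e` certified on the
cell gives, at every `s'` (same `u`, `m` ranges), `F − 4 n₂ · max (max (s₁ − s') (s' − s₂)) 0 ≤
e(t, s', u, m)` (`energyDensityTT'_ge_of_lowerBound_tPrime` from the clamp of `s'` to `[s₁, s₂]`).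
[cite: Israel1979, Thm. I.3.4] -/
theorem energyDensityTT'_ge_of_cellFloor_tPrime (t : ℝ) {U₁ U₂ s₁ s₂ n₁ n₂ F : ℝ} (hU₁ : 0 ≤ U₁)
    (hs : s₁ ≤ s₂) (hn₁ : 0 ≤ n₁) (hn₂ : n₂ < 2)
    (hF : ∀ u s m : ℝ, U₁ ≤ u → u ≤ U₂ → s₁ ≤ s → s ≤ s₂ → n₁ ≤ m → m ≤ n₂ →
      F ≤ energyDensityTT' t s u m)
    {u s' m : ℝ} (hu₁ : U₁ ≤ u) (hu₂ : u ≤ U₂) (hm₁ : n₁ ≤ m) (hm₂ : m ≤ n₂) :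
    F - 4 * n₂ * max (max (s₁ - s') (s' - s₂)) 0 ≤ energyDensityTT' t s' u m := by
  have hm0 : 0 ≤ m := hn₁.trans hm₁
  have hm2 : m < 2 := lt_of_le_of_lt hm₂ hn₂
  set s := max s₁ (min s' s₂) with hs_def
  have hs₁' : s₁ ≤ s := le_max_left _ _
  have hs₂' : s ≤ s₂ := max_le hs (min_le_right _ _)
  have h1 := hF u s m hu₁ hu₂ hs₁' hs₂' hm₁ hm₂
  have h2 := energyDensityTT'_ge_of_lowerBound_tPrime t (hU₁.trans hu₁) hm0 hm2 (s' := s') h1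
  have hd := abs_sub_clamp_le (s' := s') hs
  have h3 : 4 * m * |s' - s| ≤ 4 * n₂ * max (max (s₁ - s') (s' - s₂)) 0 := by
    have ha : 0 ≤ |s' - s| := abs_nonneg _
    have := mul_le_mul (mul_le_mul_of_nonneg_left hm₂ (by norm_num : (0:ℝ) ≤ 4)) hd ha
      (by linarith)
    linarith
  linarith

/-- **Cap read outside the cell in `t'`, Lipschitz price `4 n₂`**: `e(t, s', u, m) ≤
C + 4 n₂ · max (max (s₁ − s') (s' − s₂)) 0` (`energyDensityTT'_le_of_upperBound_tPrime`).
[cite: Israel1979, Thm. I.3.4] -/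
theorem energyDensityTT'_le_of_cellCap_tPrime (t : ℝ) {U₁ U₂ s₁ s₂ n₁ n₂ C : ℝ} (hU₁ : 0 ≤ U₁)
    (hs : s₁ ≤ s₂) (hn₁ : 0 ≤ n₁) (hn₂ : n₂ < 2)
    (hC : ∀ u s m : ℝ, U₁ ≤ u → u ≤ U₂ → s₁ ≤ s → s ≤ s₂ → n₁ ≤ m → m ≤ n₂ →
      energyDensityTT' t s u m ≤ C)
    {u s' m : ℝ} (hu₁ : U₁ ≤ u) (hu₂ : u ≤ U₂) (hm₁ : n₁ ≤ m) (hm₂ : m ≤ n₂) :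
    energyDensityTT' t s' u m ≤ C + 4 * n₂ * max (max (s₁ - s') (s' - s₂)) 0 := by
  have hm0 : 0 ≤ m := hn₁.trans hm₁
  have hm2 : m < 2 := lt_of_le_of_lt hm₂ hn₂
  set s := max s₁ (min s' s₂) with hs_def
  have hs₁' : s₁ ≤ s := le_max_left _ _
  have hs₂' : s ≤ s₂ := max_le hs (min_le_right _ _)
  have h1 := hC u s m hu₁ hu₂ hs₁' hs₂' hm₁ hm₂
  have h2 := energyDensityTT'_le_of_upperBound_tPrime t (hU₁.trans hu₁) hm0 hm2 (s' := s') h1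
  have hd := abs_sub_clamp_le (s' := s') hs
  have h3 : 4 * m * |s' - s| ≤ 4 * n₂ * max (max (s₁ - s') (s' - s₂)) 0 := by
    have ha : 0 ≤ |s' - s| := abs_nonneg _
    have := mul_le_mul (mul_le_mul_of_nonneg_left hm₂ (by norm_num : (0:ℝ) ≤ 4)) hd ha
      (by linarith)
    linarith
  linarith

/-- **The cell window read on a `t'`-extended box**: on `[U₁, U₂] × [s₀, s₃] × [n₁, n₂]` the window is
`[F − 4 n₂ δ, C + 4 n₂ δ]` with the far-edge overshoot `δ = max (max (s₁ − s₀) (s₃ − s₂)) 0`.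
[cite: Israel1979, Thm. I.3.4] -/
theorem energyDensityTT'_mem_Icc_of_cellWindow_tPrime (t : ℝ) {U₁ U₂ s₁ s₂ n₁ n₂ F C : ℝ}
    (hU₁ : 0 ≤ U₁) (hs : s₁ ≤ s₂) (hn₁ : 0 ≤ n₁) (hn₂ : n₂ < 2)
    (hW : ∀ u s m : ℝ, U₁ ≤ u → u ≤ U₂ → s₁ ≤ s → s ≤ s₂ → n₁ ≤ m → m ≤ n₂ →
      F ≤ energyDensityTT' t s u m ∧ energyDensityTT' t s u m ≤ C)
    {s₀ s₃ u s' m : ℝ} (hu₁ : U₁ ≤ u) (hu₂ : u ≤ U₂) (hs₀ : s₀ ≤ s') (hs₃ : s' ≤ s₃)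
    (hm₁ : n₁ ≤ m) (hm₂ : m ≤ n₂) :
    energyDensityTT' t s' u m ∈
      Set.Icc (F - 4 * n₂ * max (max (s₁ - s₀) (s₃ - s₂)) 0)
        (C + 4 * n₂ * max (max (s₁ - s₀) (s₃ - s₂)) 0) := by
  have hn₂0 : 0 ≤ n₂ := hn₁.trans (hm₁.trans hm₂)
  have hδ : max (max (s₁ - s') (s' - s₂)) 0 ≤ max (max (s₁ - s₀) (s₃ - s₂)) 0 :=
    max_le_max (max_le_max (by linarith) (by linarith)) le_rfl
  have hδ' := mul_le_mul_of_nonneg_left hδ (by linarith : (0:ℝ) ≤ 4 * n₂)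
  refine ⟨?_, ?_⟩
  · have h := energyDensityTT'_ge_of_cellFloor_tPrime t hU₁ hs hn₁ hn₂
      (fun u s m h₁ h₂ h₃ h₄ h₅ h₆ => (hW u s m h₁ h₂ h₃ h₄ h₅ h₆).1) (s' := s') hu₁ hu₂ hm₁ hm₂
    linarith
  · have h := energyDensityTT'_le_of_cellCap_tPrime t hU₁ hs hn₁ hn₂
      (fun u s m h₁ h₂ h₃ h₄ h₅ h₆ => (hW u s m h₁ h₂ h₃ h₄ h₅ h₆).2) (s' := s') hu₁ hu₂ hm₁ hm₂
    linarith

/-- **Floor to the RIGHT of the density interval, from the cell's own window** (pointwise): the cap at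
`n₁` and the floor at `n₂` extrapolate by convexity in the density to
`F + (F − C)(m − n₂)/(n₂ − n₁) ≤ e(t, s, u, m)` for `n₂ < m < 2`.
[cite: Ruelle1969, §3.3] -/
theorem energyDensityTT'_ge_of_cellWindow_density_right (t : ℝ) {U₁ U₂ s₁ s₂ n₁ n₂ F C : ℝ}
    (hU₁ : 0 ≤ U₁) (hn₁ : 0 ≤ n₁) (hn : n₁ < n₂)
    (hW : ∀ u s m : ℝ, U₁ ≤ u → u ≤ U₂ → s₁ ≤ s → s ≤ s₂ → n₁ ≤ m → m ≤ n₂ →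
      F ≤ energyDensityTT' t s u m ∧ energyDensityTT' t s u m ≤ C)
    {u s m : ℝ} (hu₁ : U₁ ≤ u) (hu₂ : u ≤ U₂) (hs₁ : s₁ ≤ s) (hs₂ : s ≤ s₂) (hm : n₂ < m)
    (hm2 : m < 2) : F + (F - C) * (m - n₂) / (n₂ - n₁) ≤ energyDensityTT' t s u m :=
  energyDensityTT'_ge_density_extrapolate_right t s (hU₁.trans hu₁) hn₁ hn hm hm2
    (hW u s n₁ hu₁ hu₂ hs₁ hs₂ le_rfl hn.le).2 (hW u s n₂ hu₁ hu₂ hs₁ hs₂ hn.le le_rfl).1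

/-- **Floor to the LEFT of the density interval, from the cell's own window** (pointwise):
`F + (F − C)(n₁ − m)/(n₂ − n₁) ≤ e(t, s, u, m)` for `0 ≤ m < n₁` (floor at `n₁`, cap at `n₂`).
[cite: Ruelle1969, §3.3] -/
theorem energyDensityTT'_ge_of_cellWindow_density_left (t : ℝ) {U₁ U₂ s₁ s₂ n₁ n₂ F C : ℝ}
    (hU₁ : 0 ≤ U₁) (hn : n₁ < n₂) (hn₂ : n₂ < 2)
    (hW : ∀ u s m : ℝ, U₁ ≤ u → u ≤ U₂ → s₁ ≤ s → s ≤ s₂ → n₁ ≤ m → m ≤ n₂ →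
      F ≤ energyDensityTT' t s u m ∧ energyDensityTT' t s u m ≤ C)
    {u s m : ℝ} (hu₁ : U₁ ≤ u) (hu₂ : u ≤ U₂) (hs₁ : s₁ ≤ s) (hs₂ : s ≤ s₂) (hm0 : 0 ≤ m)
    (hm : m < n₁) : F + (F - C) * (n₁ - m) / (n₂ - n₁) ≤ energyDensityTT' t s u m :=
  energyDensityTT'_ge_density_extrapolate_left t s (hU₁.trans hu₁) hm0 hm hn hn₂
    (hW u s n₂ hu₁ hu₂ hs₁ hs₂ hn.le le_rfl).2 (hW u s n₁ hu₁ hu₂ hs₁ hs₂ le_rfl hn.le).1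

/-- An affine function `F + k·d` on `0 ≤ d ≤ D` is bounded below by the smaller end value. [folklore] -/
private theorem min_le_add_mul {F k d D : ℝ} (hd : 0 ≤ d) (hD : d ≤ D) :
    min F (F + k * D) ≤ F + k * d := by
  rcases le_total 0 k with hk | hk
  · exact (min_le_left _ _).trans (le_add_of_nonneg_right (mul_nonneg hk hd))
  · have := mul_le_mul_of_nonpos_left hD hk
    exact (min_le_right _ _).trans (by linarith)

/-- **Uniform floor on the density slab `[n₂, n₃]` to the right of the cell** (`n₃ < 2`):
`min F (F + (F − C)(n₃ − n₂)/(n₂ − n₁)) ≤ e(t, s, u, m)` for all `(u, s)` in the cell's rectangle and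
`n₂ ≤ m ≤ n₃` — the extrapolated floor is affine in `m`, so its minimum over the slab is an end value.
No cap is claimed on the slab. [cite: Ruelle1969, §3.3] -/
theorem energyDensityTT'_ge_min_of_cellWindow_density_right (t : ℝ) {U₁ U₂ s₁ s₂ n₁ n₂ F C : ℝ}
    (hU₁ : 0 ≤ U₁) (hn₁ : 0 ≤ n₁) (hn : n₁ < n₂)
    (hW : ∀ u s m : ℝ, U₁ ≤ u → u ≤ U₂ → s₁ ≤ s → s ≤ s₂ → n₁ ≤ m → m ≤ n₂ →
      F ≤ energyDensityTT' t s u m ∧ energyDensityTT' t s u m ≤ C)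
    {n₃ : ℝ} (hn₃ : n₃ < 2) {u s m : ℝ} (hu₁ : U₁ ≤ u) (hu₂ : u ≤ U₂) (hs₁ : s₁ ≤ s)
    (hs₂ : s ≤ s₂) (hm : n₂ ≤ m) (hm₃ : m ≤ n₃) :
    min F (F + (F - C) * (n₃ - n₂) / (n₂ - n₁)) ≤ energyDensityTT' t s u m := by
  rcases eq_or_lt_of_le hm with h | h
  · rw [← h]
    exact (min_le_left _ _).trans (hW u s n₂ hu₁ hu₂ hs₁ hs₂ hn.le le_rfl).1
  · have h1 := energyDensityTT'_ge_of_cellWindow_density_right t hU₁ hn₁ hn hW hu₁ hu₂ hs₁ hs₂ h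
      (lt_of_le_of_lt hm₃ hn₃)
    have e1 : F + (F - C) * (m - n₂) / (n₂ - n₁) = F + (F - C) / (n₂ - n₁) * (m - n₂) := by
      rw [mul_div_right_comm]
    have e2 : F + (F - C) * (n₃ - n₂) / (n₂ - n₁) = F + (F - C) / (n₂ - n₁) * (n₃ - n₂) := by
      rw [mul_div_right_comm]
    rw [e2]
    rw [e1] at h1
    exact (min_le_add_mul (by linarith) (by linarith : m - n₂ ≤ n₃ - n₂)).trans h1

/-- **Uniform floor on the density slab `[n₀, n₁]` to the left of the cell** (`0 ≤ n₀`):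
`min F (F + (F − C)(n₁ − n₀)/(n₂ − n₁)) ≤ e(t, s, u, m)` for `n₀ ≤ m ≤ n₁`. [cite: Ruelle1969, §3.3] -/
theorem energyDensityTT'_ge_min_of_cellWindow_density_left (t : ℝ) {U₁ U₂ s₁ s₂ n₁ n₂ F C : ℝ}
    (hU₁ : 0 ≤ U₁) (hn : n₁ < n₂) (hn₂ : n₂ < 2)
    (hW : ∀ u s m : ℝ, U₁ ≤ u → u ≤ U₂ → s₁ ≤ s → s ≤ s₂ → n₁ ≤ m → m ≤ n₂ →
      F ≤ energyDensityTT' t s u m ∧ energyDensityTT' t s u m ≤ C)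
    {n₀ : ℝ} (hn₀ : 0 ≤ n₀) {u s m : ℝ} (hu₁ : U₁ ≤ u) (hu₂ : u ≤ U₂) (hs₁ : s₁ ≤ s)
    (hs₂ : s ≤ s₂) (hm₀ : n₀ ≤ m) (hm : m ≤ n₁) :
    min F (F + (F - C) * (n₁ - n₀) / (n₂ - n₁)) ≤ energyDensityTT' t s u m := by
  rcases eq_or_lt_of_le hm with h | h
  · rw [h]
    exact (min_le_left _ _).trans (hW u s n₁ hu₁ hu₂ hs₁ hs₂ le_rfl hn.le).1
  · have h1 := energyDensityTT'_ge_of_cellWindow_density_left t hU₁ hn hn₂ hW hu₁ hu₂ hs₁ hs₂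
      (hn₀.trans hm₀) h
    have e1 : F + (F - C) * (n₁ - m) / (n₂ - n₁) = F + (F - C) / (n₂ - n₁) * (n₁ - m) := by
      rw [mul_div_right_comm]
    have e2 : F + (F - C) * (n₁ - n₀) / (n₂ - n₁) = F + (F - C) / (n₂ - n₁) * (n₁ - n₀) := by
      rw [mul_div_right_comm]
    rw [e2]
    rw [e1] at h1
    exact (min_le_add_mul (by linarith) (by linarith : n₁ - m ≤ n₁ - n₀)).trans h1

/-! ### §2 The S2-seam shape: words on `Set.Icc ![U₁, s₁, n₁] ![U₂, s₂, n₂] ⊆ (Fin 3 → ℝ)` -/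

/-- Membership of a `Fin 3` vector in a box with `![…]` corners is the six scalar inequalities.
[cite: Neumaier2004CompleteSearch, §11] -/
theorem mem_Icc_vec3_iff {a₀ a₁ a₂ b₀ b₁ b₂ : ℝ} {θ : Fin 3 → ℝ} :
    θ ∈ Set.Icc (![a₀, a₁, a₂] : Fin 3 → ℝ) ![b₀, b₁, b₂] ↔
      (a₀ ≤ θ 0 ∧ θ 0 ≤ b₀) ∧ (a₁ ≤ θ 1 ∧ θ 1 ≤ b₁) ∧ (a₂ ≤ θ 2 ∧ θ 2 ≤ b₂) := by
  constructor
  · rintro ⟨h1, h2⟩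
    exact ⟨⟨by simpa using h1 0, by simpa using h2 0⟩, ⟨by simpa using h1 1, by simpa using h2 1⟩,
      ⟨by simpa using h1 2, by simpa using h2 2⟩⟩
  · rintro ⟨⟨h1, h2⟩, ⟨h3, h4⟩, ⟨h5, h6⟩⟩
    refine ⟨fun k => ?_, fun k => ?_⟩ <;> fin_cases k <;> simp [h1, h2, h3, h4, h5, h6]

/-- **Vector box ⇒ scalar letters.** A statement `P (θ 0) (θ 1) (θ 2)` on the box
`Set.Icc ![a₀, a₁, a₂] ![b₀, b₁, b₂]` holds in the scalar letters under the six inequalities.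
[cite: Neumaier2004CompleteSearch, §11] -/
theorem forall₃_of_forall_mem_Icc_vec3 {P : ℝ → ℝ → ℝ → Prop} {a₀ a₁ a₂ b₀ b₁ b₂ : ℝ}
    (h : ∀ θ ∈ Set.Icc (![a₀, a₁, a₂] : Fin 3 → ℝ) ![b₀, b₁, b₂], P (θ 0) (θ 1) (θ 2))
    {x y z : ℝ} (hx₁ : a₀ ≤ x) (hx₂ : x ≤ b₀) (hy₁ : a₁ ≤ y) (hy₂ : y ≤ b₁) (hz₁ : a₂ ≤ z)
    (hz₂ : z ≤ b₂) : P x y z := by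
  have := h ![x, y, z] (mem_Icc_vec3_iff.2 ⟨⟨by simpa using hx₁, by simpa using hx₂⟩,
    ⟨by simpa using hy₁, by simpa using hy₂⟩, ⟨by simpa using hz₁, by simpa using hz₂⟩⟩)
  simpa using this

/-- **Scalar letters ⇒ vector box.** [cite: Neumaier2004CompleteSearch, §11] -/
theorem forall_mem_Icc_vec3_of_forall₃ {P : ℝ → ℝ → ℝ → Prop} {a₀ a₁ a₂ b₀ b₁ b₂ : ℝ}
    (h : ∀ x y z : ℝ, a₀ ≤ x → x ≤ b₀ → a₁ ≤ y → y ≤ b₁ → a₂ ≤ z → z ≤ b₂ → P x y z) :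
    ∀ θ ∈ Set.Icc (![a₀, a₁, a₂] : Fin 3 → ℝ) ![b₀, b₁, b₂], P (θ 0) (θ 1) (θ 2) := by
  intro θ hθ
  obtain ⟨⟨h1, h2⟩, ⟨h3, h4⟩, ⟨h5, h6⟩⟩ := mem_Icc_vec3_iff.1 hθ
  exact h _ _ _ h1 h2 h3 h4 h5 h6

/-- **Floor on the `U`-shadow above, seam shape.** From the window on `Set.Icc ![U₁, s₁, n₁]
![U₂, s₂, n₂]` (`0 ≤ U₁ ≤ U₂`, `0 ≤ n₁`, `n₂ < 2`): the FLOOR on `Set.Icc ![U₁, s₁, n₁] ![U₃, s₂, n₂]` for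
ANY `U₃` — zero loss. [cite: Ruelle1969, §3.3] -/
theorem energyDensityTT'_floor_Icc₃_U_above (t : ℝ) {U₁ U₂ s₁ s₂ n₁ n₂ F : ℝ} (hU₁ : 0 ≤ U₁)
    (hU : U₁ ≤ U₂) (hn₁ : 0 ≤ n₁) (hn₂ : n₂ < 2)
    (hF : ∀ θ ∈ Set.Icc (![U₁, s₁, n₁] : Fin 3 → ℝ) ![U₂, s₂, n₂],
      F ≤ energyDensityTT' t (θ 1) (θ 0) (θ 2))
    (U₃ : ℝ) :
    ∀ θ ∈ Set.Icc (![U₁, s₁, n₁] : Fin 3 → ℝ) ![U₃, s₂, n₂],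
      F ≤ energyDensityTT' t (θ 1) (θ 0) (θ 2) := by
  intro θ hθ
  obtain ⟨⟨h1, -⟩, ⟨h3, h4⟩, ⟨h5, h6⟩⟩ := mem_Icc_vec3_iff.1 hθ
  exact energyDensityTT'_ge_of_cellFloor_U_above t hU₁ hU hn₁ hn₂
    (fun u s m a b c d e f =>
      forall₃_of_forall_mem_Icc_vec3 (P := fun u s m => F ≤ energyDensityTT' t s u m) hF a b c d e f)
    h1 h3 h4 h5 h6

/-- **Window on a `U`-extended box, seam shape.** From the window `[F, C]` on `Set.Icc ![U₁, s₁, n₁]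
![U₂, s₂, n₂]`: on `Set.Icc ![U₀, s₁, n₁] ![U₃, s₂, n₂]` (`0 ≤ U₀`) the window
`[F − max (U₁ − U₀) 0 · (n₂/2)², C + max (U₃ − U₂) 0 · (n₂/2)²]`. [cite: BachLiebSolovej1994, eq. (2c.36)] -/
theorem energyDensityTT'_window_Icc₃_U (t : ℝ) {U₁ U₂ s₁ s₂ n₁ n₂ F C : ℝ} (hU₁ : 0 ≤ U₁)
    (hU : U₁ ≤ U₂) (hn₁ : 0 ≤ n₁) (hn₂ : n₂ < 2)
    (hW : ∀ θ ∈ Set.Icc (![U₁, s₁, n₁] : Fin 3 → ℝ) ![U₂, s₂, n₂],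
      F ≤ energyDensityTT' t (θ 1) (θ 0) (θ 2) ∧ energyDensityTT' t (θ 1) (θ 0) (θ 2) ≤ C)
    {U₀ : ℝ} (hU₀ : 0 ≤ U₀) (U₃ : ℝ) :
    ∀ θ ∈ Set.Icc (![U₀, s₁, n₁] : Fin 3 → ℝ) ![U₃, s₂, n₂],
      F - max (U₁ - U₀) 0 * (n₂ / 2) ^ 2 ≤ energyDensityTT' t (θ 1) (θ 0) (θ 2) ∧
        energyDensityTT' t (θ 1) (θ 0) (θ 2) ≤ C + max (U₃ - U₂) 0 * (n₂ / 2) ^ 2 := by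
  intro θ hθ
  obtain ⟨⟨h1, h2⟩, ⟨h3, h4⟩, ⟨h5, h6⟩⟩ := mem_Icc_vec3_iff.1 hθ
  exact energyDensityTT'_mem_Icc_of_cellWindow_U t hU₁ hU hn₁ hn₂
    (fun u s m a b c d e f => forall₃_of_forall_mem_Icc_vec3
      (P := fun u s m => F ≤ energyDensityTT' t s u m ∧ energyDensityTT' t s u m ≤ C) hW a b c d e f)
    hU₀ h1 h2 h3 h4 h5 h6

/-- **Window on a `t'`-extended box, seam shape.** From the window `[F, C]` on `Set.Icc ![U₁, s₁, n₁]
![U₂, s₂, n₂]` (`0 ≤ U₁`, `s₁ ≤ s₂`): on `Set.Icc ![U₁, s₀, n₁] ![U₂, s₃, n₂]` the window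
`[F − 4 n₂ δ, C + 4 n₂ δ]`, `δ = max (max (s₁ − s₀) (s₃ − s₂)) 0`. [cite: Israel1979, Thm. I.3.4] -/
theorem energyDensityTT'_window_Icc₃_tPrime (t : ℝ) {U₁ U₂ s₁ s₂ n₁ n₂ F C : ℝ} (hU₁ : 0 ≤ U₁)
    (hs : s₁ ≤ s₂) (hn₁ : 0 ≤ n₁) (hn₂ : n₂ < 2)
    (hW : ∀ θ ∈ Set.Icc (![U₁, s₁, n₁] : Fin 3 → ℝ) ![U₂, s₂, n₂],
      F ≤ energyDensityTT' t (θ 1) (θ 0) (θ 2) ∧ energyDensityTT' t (θ 1) (θ 0) (θ 2) ≤ C)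
    (s₀ s₃ : ℝ) :
    ∀ θ ∈ Set.Icc (![U₁, s₀, n₁] : Fin 3 → ℝ) ![U₂, s₃, n₂],
      F - 4 * n₂ * max (max (s₁ - s₀) (s₃ - s₂)) 0 ≤ energyDensityTT' t (θ 1) (θ 0) (θ 2) ∧
        energyDensityTT' t (θ 1) (θ 0) (θ 2) ≤ C + 4 * n₂ * max (max (s₁ - s₀) (s₃ - s₂)) 0 := by
  intro θ hθ
  obtain ⟨⟨h1, h2⟩, ⟨h3, h4⟩, ⟨h5, h6⟩⟩ := mem_Icc_vec3_iff.1 hθ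
  exact energyDensityTT'_mem_Icc_of_cellWindow_tPrime t hU₁ hs hn₁ hn₂
    (fun u s m a b c d e f => forall₃_of_forall_mem_Icc_vec3
      (P := fun u s m => F ≤ energyDensityTT' t s u m ∧ energyDensityTT' t s u m ≤ C) hW a b c d e f)
    h1 h2 h3 h4 h5 h6

/-- **Floor on the density slab to the right, seam shape.** From the window `[F, C]` on
`Set.Icc ![U₁, s₁, n₁] ![U₂, s₂, n₂]` (`0 ≤ U₁`, `0 ≤ n₁ < n₂`): on `Set.Icc ![U₁, s₁, n₂] ![U₂, s₂, n₃]`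
(`n₃ < 2`) the floor `min F (F + (F − C)(n₃ − n₂)/(n₂ − n₁))`; no cap. [cite: Ruelle1969, §3.3] -/
theorem energyDensityTT'_floor_Icc₃_density_right (t : ℝ) {U₁ U₂ s₁ s₂ n₁ n₂ F C : ℝ}
    (hU₁ : 0 ≤ U₁) (hn₁ : 0 ≤ n₁) (hn : n₁ < n₂)
    (hW : ∀ θ ∈ Set.Icc (![U₁, s₁, n₁] : Fin 3 → ℝ) ![U₂, s₂, n₂],
      F ≤ energyDensityTT' t (θ 1) (θ 0) (θ 2) ∧ energyDensityTT' t (θ 1) (θ 0) (θ 2) ≤ C)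
    {n₃ : ℝ} (hn₃ : n₃ < 2) :
    ∀ θ ∈ Set.Icc (![U₁, s₁, n₂] : Fin 3 → ℝ) ![U₂, s₂, n₃],
      min F (F + (F - C) * (n₃ - n₂) / (n₂ - n₁)) ≤ energyDensityTT' t (θ 1) (θ 0) (θ 2) := by
  intro θ hθ
  obtain ⟨⟨h1, h2⟩, ⟨h3, h4⟩, ⟨h5, h6⟩⟩ := mem_Icc_vec3_iff.1 hθ
  exact energyDensityTT'_ge_min_of_cellWindow_density_right t hU₁ hn₁ hn
    (fun u s m a b c d e f => forall₃_of_forall_mem_Icc_vec3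
      (P := fun u s m => F ≤ energyDensityTT' t s u m ∧ energyDensityTT' t s u m ≤ C) hW a b c d e f)
    hn₃ h1 h2 h3 h4 h5 h6

/-- **Floor on the density slab to the left, seam shape.** From the window `[F, C]` on
`Set.Icc ![U₁, s₁, n₁] ![U₂, s₂, n₂]` (`0 ≤ U₁`, `n₁ < n₂ < 2`): on `Set.Icc ![U₁, s₁, n₀] ![U₂, s₂, n₁]`
(`0 ≤ n₀`) the floor `min F (F + (F − C)(n₁ − n₀)/(n₂ − n₁))`; no cap. [cite: Ruelle1969, §3.3] -/
theorem energyDensityTT'_floor_Icc₃_density_left (t : ℝ) {U₁ U₂ s₁ s₂ n₁ n₂ F C : ℝ}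
    (hU₁ : 0 ≤ U₁) (hn : n₁ < n₂) (hn₂ : n₂ < 2)
    (hW : ∀ θ ∈ Set.Icc (![U₁, s₁, n₁] : Fin 3 → ℝ) ![U₂, s₂, n₂],
      F ≤ energyDensityTT' t (θ 1) (θ 0) (θ 2) ∧ energyDensityTT' t (θ 1) (θ 0) (θ 2) ≤ C)
    {n₀ : ℝ} (hn₀ : 0 ≤ n₀) :
    ∀ θ ∈ Set.Icc (![U₁, s₁, n₀] : Fin 3 → ℝ) ![U₂, s₂, n₁],
      min F (F + (F - C) * (n₁ - n₀) / (n₂ - n₁)) ≤ energyDensityTT' t (θ 1) (θ 0) (θ 2) := by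
  intro θ hθ
  obtain ⟨⟨h1, h2⟩, ⟨h3, h4⟩, ⟨h5, h6⟩⟩ := mem_Icc_vec3_iff.1 hθ
  exact energyDensityTT'_ge_min_of_cellWindow_density_left t hU₁ hn hn₂
    (fun u s m a b c d e f => forall₃_of_forall_mem_Icc_vec3
      (P := fun u s m => F ≤ energyDensityTT' t s u m ∧ energyDensityTT' t s u m ≤ C) hW a b c d e f)
    hn₀ h1 h2 h3 h4 h5 h6

/-! ### §3 Caps at the two density ends of a slab ⇒ a cap on the 3-D slab (for `U`-uniform cap planes) -/

/-- An affine function of `s` on `[s₁, s₂]` is below the larger of its endpoint values. [folklore] -/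
private theorem affine_le_max_endpoints {a b s s₁ s₂ : ℝ} (h₁ : s₁ ≤ s) (h₂ : s ≤ s₂) :
    a + s * b ≤ max (a + s₁ * b) (a + s₂ * b) := by
  rcases le_total 0 b with hb | hb
  · exact le_trans (by nlinarith) (le_max_right _ _)
  · exact le_trans (by nlinarith) (le_max_left _ _)

/-- **Caps at two densities cap everything between** (convexity of `n ↦ e`: the chord lies below the
larger end value; `energyDensityTT'_le_density_chord`). [cite: Ruelle1969, §3.3] -/
theorem energyDensityTT'_le_max_of_caps_density (t s : ℝ) {U : ℝ} (hU : 0 ≤ U) {na nb Ca Cb : ℝ}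
    (hna : 0 ≤ na) (hnb : nb < 2) (ha : energyDensityTT' t s U na ≤ Ca)
    (hb : energyDensityTT' t s U nb ≤ Cb) {m : ℝ} (h₁ : na ≤ m) (h₂ : m ≤ nb) :
    energyDensityTT' t s U m ≤ max Ca Cb := by
  rcases eq_or_lt_of_le h₁ with e₁ | l₁
  · rw [← e₁]; exact ha.trans (le_max_left _ _)
  rcases eq_or_lt_of_le h₂ with e₂ | l₂
  · rw [e₂]; exact hb.trans (le_max_right _ _)
  have hch := energyDensityTT'_le_density_chord t s hU hna l₁ l₂ hnb ha hb
  have hd : 0 < nb - na := by linarith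
  refine hch.trans ?_
  rw [div_le_iff₀ hd]
  have k1 : (nb - m) * Ca ≤ (nb - m) * max Ca Cb :=
    mul_le_mul_of_nonneg_left (le_max_left _ _) (by linarith)
  have k2 : (m - na) * Cb ≤ (m - na) * max Ca Cb :=
    mul_le_mul_of_nonneg_left (le_max_right _ _) (by linarith)
  nlinarith

/-- **Cap on a 3-D slab from caps AFFINE in `t'` at its two density ends, seam shape.** If on the
rectangle `[s₁, s₂] × [U₀, U₃]` (`0 ≤ U₀`) the energy is capped at density `na` by `Aa + s·Ba` and at
density `nb` by `Ab + s·Bb` (`0 ≤ na`, `nb < 2`) — e.g. two polarised-sea cap planes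
(`TTPrimeFree.energyDensityTT'_le_polarizedSea_plane`, valid at EVERY `U ≥ 0`, so `U₃` is free), or a
plane at one end and a cell cap (`Ba = 0`) at the other — then on `Set.Icc ![U₀, s₁, na] ![U₃, s₂, nb]`
the energy is below the corner maximum `max (max (Aa + s₁Ba) (Aa + s₂Ba)) (max (Ab + s₁Bb) (Ab + s₂Bb))`.
This is the cap half the density slabs of §1/§2 lack. [cite: Ruelle1969, §3.3] -/
theorem energyDensityTT'_cap_Icc₃_of_affineCaps (t : ℝ) {s₁ s₂ U₀ U₃ na nb Aa Ba Ab Bb : ℝ}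
    (hU₀ : 0 ≤ U₀) (hna : 0 ≤ na) (hnb : nb < 2)
    (hCa : ∀ s u : ℝ, s₁ ≤ s → s ≤ s₂ → U₀ ≤ u → u ≤ U₃ → energyDensityTT' t s u na ≤ Aa + s * Ba)
    (hCb : ∀ s u : ℝ, s₁ ≤ s → s ≤ s₂ → U₀ ≤ u → u ≤ U₃ → energyDensityTT' t s u nb ≤ Ab + s * Bb) :
    ∀ θ ∈ Set.Icc (![U₀, s₁, na] : Fin 3 → ℝ) ![U₃, s₂, nb],
      energyDensityTT' t (θ 1) (θ 0) (θ 2) ≤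
        max (max (Aa + s₁ * Ba) (Aa + s₂ * Ba)) (max (Ab + s₁ * Bb) (Ab + s₂ * Bb)) := by
  intro θ hθ
  obtain ⟨⟨h1, h2⟩, ⟨h3, h4⟩, ⟨h5, h6⟩⟩ := mem_Icc_vec3_iff.1 hθ
  have ha := (hCa (θ 1) (θ 0) h3 h4 h1 h2).trans (affine_le_max_endpoints h3 h4)
  have hb := (hCb (θ 1) (θ 0) h3 h4 h1 h2).trans (affine_le_max_endpoints h3 h4)
  exact energyDensityTT'_le_max_of_caps_density t (θ 1) (hU₀.trans h1) hna hnb ha hb h5 h6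

/-- **Two cap words on the same box combine by `min`** (e.g. the Lipschitz-extended cell cap of
`energyDensityTT'_window_Icc₃_U` and a `U`-uniform polarised-sea cap). [cite: Neumaier2004CompleteSearch, §11] -/
theorem energyDensityTT'_cap_Icc₃_min (t : ℝ) {lo hi : Fin 3 → ℝ} {C₁ C₂ : ℝ}
    (h₁ : ∀ θ ∈ Set.Icc lo hi, energyDensityTT' t (θ 1) (θ 0) (θ 2) ≤ C₁)
    (h₂ : ∀ θ ∈ Set.Icc lo hi, energyDensityTT' t (θ 1) (θ 0) (θ 2) ≤ C₂) :
    ∀ θ ∈ Set.Icc lo hi, energyDensityTT' t (θ 1) (θ 0) (θ 2) ≤ min C₁ C₂ :=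
  fun θ hθ => le_min (h₁ θ hθ) (h₂ θ hθ)

/-- **A floor word and a cap word on the same box are a window.** [cite: Neumaier2004CompleteSearch, §11] -/
theorem energyDensityTT'_window_Icc₃_of_floor_of_cap (t : ℝ) {lo hi : Fin 3 → ℝ} {F C : ℝ}
    (hF : ∀ θ ∈ Set.Icc lo hi, F ≤ energyDensityTT' t (θ 1) (θ 0) (θ 2))
    (hC : ∀ θ ∈ Set.Icc lo hi, energyDensityTT' t (θ 1) (θ 0) (θ 2) ≤ C) :
    ∀ θ ∈ Set.Icc lo hi,
      F ≤ energyDensityTT' t (θ 1) (θ 0) (θ 2) ∧ energyDensityTT' t (θ 1) (θ 0) (θ 2) ≤ C :=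
  fun θ hθ => ⟨hF θ hθ, hC θ hθ⟩

/-! ### §3 Density-extent cells of the box-dual reader: a cap affine along the density axis

The `boxdual/0` reader (hubbard-box-eng-3, BOXDUAL-FORMAT §11) words a 3-D cell
`[U₀, U₃] × [s₁, s₂] × [na, nb]` from eight corner programs whose energy-cap rows carry the values of two
LAYER planes `Aa + Ba·s + Ca·u` (certified cap at density `na` on the whole rectangle) and
`Ab + Bb·s + Cb·u` (at `nb`); the interpolant program at an interior `θ` carries the multi-affine
interpolant of the eight corner caps, which is the density CHORD of the two layer planes. The two
theorems below say that this interpolated cap majorises the energy density on the whole cell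
(convexity in the density, `energyDensityTT'_le_density_chord`); nothing else about the cell is used. -/

/-- **Density chord of two layer cap planes caps the 3-D cell** (division-free form). If
`e(t, s, u, na) ≤ Aa + Ba s + Ca u` and `e(t, s, u, nb) ≤ Ab + Bb s + Cb u` for all `(s, u)` in
`[s₁, s₂] × [U₀, U₃]` (`0 ≤ U₀`, `0 ≤ na < nb < 2`), then for every `θ = (u, s, m)` of the cell
`(nb − na)·e(t, s, u, m) ≤ (nb − m)(Aa + Ba s + Ca u) + (m − na)(Ab + Bb s + Cb u)`.
[cite: Ruelle1969, §3.3] -/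
theorem energyDensityTT'_densityChord_cap_Icc₃_of_layerPlanes (t : ℝ) {s₁ s₂ U₀ U₃ na nb Aa Ba Ca Ab Bb Cb : ℝ}
    (hU₀ : 0 ≤ U₀) (hna : 0 ≤ na) (hab : na < nb) (hnb : nb < 2)
    (hCa : ∀ s u : ℝ, s₁ ≤ s → s ≤ s₂ → U₀ ≤ u → u ≤ U₃ → energyDensityTT' t s u na ≤ Aa + Ba * s + Ca * u)
    (hCb : ∀ s u : ℝ, s₁ ≤ s → s ≤ s₂ → U₀ ≤ u → u ≤ U₃ → energyDensityTT' t s u nb ≤ Ab + Bb * s + Cb * u) :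
    ∀ θ ∈ Set.Icc (![U₀, s₁, na] : Fin 3 → ℝ) ![U₃, s₂, nb],
      (nb - na) * energyDensityTT' t (θ 1) (θ 0) (θ 2) ≤
        (nb - θ 2) * (Aa + Ba * θ 1 + Ca * θ 0) + (θ 2 - na) * (Ab + Bb * θ 1 + Cb * θ 0) := by
  intro θ hθ
  obtain ⟨⟨h1, h2⟩, ⟨h3, h4⟩, ⟨h5, h6⟩⟩ := mem_Icc_vec3_iff.1 hθ
  have ha := hCa (θ 1) (θ 0) h3 h4 h1 h2
  have hb := hCb (θ 1) (θ 0) h3 h4 h1 h2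
  have hU : 0 ≤ θ 0 := hU₀.trans h1
  rcases eq_or_lt_of_le h5 with e₅ | l₅
  · rw [← e₅]
    nlinarith
  rcases eq_or_lt_of_le h6 with e₆ | l₆
  · rw [e₆]
    nlinarith
  have hch := energyDensityTT'_le_density_chord t (θ 1) hU hna l₅ l₆ hnb ha hb
  have hd : 0 < nb - na := by linarith
  rw [le_div_iff₀ hd] at hch
  linarith

/-- **A cap affine along the density axis, valid on the two end layers, is valid on the whole cell.**
`M u s m` is any function satisfying the chord identity in `m` (affine in the density for fixed
`(u, s)`: e.g. the eight-corner multi-affine interpolant `c₀ + c_U u + c_s s + c_n m + c_{Un} u m + c_{sn} s m`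
fitted by the reader) that majorises the energy density on the end layers `m = na` and `m = nb` over
the rectangle; then `e ≤ M` at every point of `[U₀, U₃] × [s₁, s₂] × [na, nb]`. This is the validity
statement of the interpolated cap row of a density-extent `boxdual/0` cell. [cite: Ruelle1969, §3.3] -/
theorem energyDensityTT'_le_densityAffineCap_Icc₃ (t : ℝ) {s₁ s₂ U₀ U₃ na nb : ℝ} (M : ℝ → ℝ → ℝ → ℝ)
    (hU₀ : 0 ≤ U₀) (hna : 0 ≤ na) (hab : na < nb) (hnb : nb < 2)
    (hM : ∀ u s m : ℝ, (nb - na) * M u s m = (nb - m) * M u s na + (m - na) * M u s nb)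
    (hCa : ∀ s u : ℝ, s₁ ≤ s → s ≤ s₂ → U₀ ≤ u → u ≤ U₃ → energyDensityTT' t s u na ≤ M u s na)
    (hCb : ∀ s u : ℝ, s₁ ≤ s → s ≤ s₂ → U₀ ≤ u → u ≤ U₃ → energyDensityTT' t s u nb ≤ M u s nb) :
    ∀ θ ∈ Set.Icc (![U₀, s₁, na] : Fin 3 → ℝ) ![U₃, s₂, nb],
      energyDensityTT' t (θ 1) (θ 0) (θ 2) ≤ M (θ 0) (θ 1) (θ 2) := by
  intro θ hθ
  obtain ⟨⟨h1, h2⟩, ⟨h3, h4⟩, ⟨h5, h6⟩⟩ := mem_Icc_vec3_iff.1 hθ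
  have ha := hCa (θ 1) (θ 0) h3 h4 h1 h2
  have hb := hCb (θ 1) (θ 0) h3 h4 h1 h2
  have hU : 0 ≤ θ 0 := hU₀.trans h1
  have hd : 0 < nb - na := by linarith
  have hid := hM (θ 0) (θ 1) (θ 2)
  rcases eq_or_lt_of_le h5 with e₅ | l₅
  · rw [← e₅]; exact ha
  rcases eq_or_lt_of_le h6 with e₆ | l₆
  · rw [e₆]; exact hb
  have hch := energyDensityTT'_le_density_chord t (θ 1) hU hna l₅ l₆ hnb ha hb
  rw [le_div_iff₀ hd] at hch
  nlinarith

end ThermodynamicLimit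

end Literature.MathematicalPhysics.QuantumLattice

end
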